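/-
Origin: expansion seat `planner-pub-hodgecm-pv01-g2-0`, handover v2 2026-08-18T05:01:15Z (`HOME/pub-hodgecm-pv01-g2/lean/Pv01g2/RealApproximationBall.lean`, md5 1877cdea, 201 lines);
landed by the gen-6 packager in gate run 22 as `HodgeCM/PerL34/RealApproximationBall.lean` (import ^import Pv[0-9]+g[0-9]+\.→import HodgeCM.PerL34. ×1; stripped 1 #print/#check/#eval lines).
-/
/-
Copyright: pub-hodgecm formalisation cell (harness21, 2026). New file (not vendored).
Origin: HOME/pub-hodgecm-pv01-g2/lean/Pv01g2/RealApproximationBall.lean (WIP module `Pv01g2.RealApproximationBall`;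
intended final place `HodgeCM/PerL34/RealApproximationBall.lean` = module `HodgeCM.PerL34.RealApproximationBall`;
on landing the import `Pv01g2.RealApproximation` becomes `HodgeCM.PerL34.RealApproximation`)
(seat planner-pub-hodgecm-pv01-g2-0; PRINT leaf `FormsModelT.Print_dense` of DAG node N33e, PerL v5 Prop 4.3,
tex ll. 672–677, for the ball model of `HodgeCM.PerL34.Ball` / `BallGlue`).
-/
import Summits.HodgeConjecture.HodgeCM.PerL34.Ball_2
import Summits.HodgeConjecture.HodgeCM.CM.Basic
import Summits.HodgeConjecture.HodgeCM.PerL34.RealApproximation_2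

/-!
# `Print_dense` for the ball model: the image of `G_U(L₀)` is dense in `U(2,1)`

Dictionary (PerL v5 ll. 667–677; LEMMAS.md §3 D2).  `(V₃, h)` is a hermitian 3-space over the CM field `L`
(`HodgeCM.HermSpace3 L ι₁`: Gram matrix `V.Hm`, hermitian for `conjRingHomK L`, of signature `(2,1)` at `ι₁`),
`G_U = U(V₃, h)` its unitary group over `L₀`, whose group of `L₀`-points is
`unitaryGroup (conjRingHomK L) V.Hm ≤ GL₃(L)` (`HodgeCM/Vendored/Hermitian.lean`), and `U(2,1) = BallModel.U21`.
A FRAME at `ι₁` is a `T ∈ GL₃(ℂ)` with `Tᴴ Hm^{ι₁} T = J = diag(1,1,-1)`; one exists by `HermSpace3.signature_ι₁`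
(`exists_frame`).  The identification `G_U(L₀ ⊗ ℝ)|_{ι₁} = U(Hm^{ι₁}) ≅ U(J) = U(2,1)` is `G ↦ T⁻¹ G T`, so

* `toU21 V T hT : unitaryGroup (conjRingHomK L) V.Hm →* BallModel.U21`, `g ↦ T⁻¹ g^{ι₁} T`, and
* `Delta V T hT := (toU21 V T hT).range` — "the image `Δ` of `G_U(L₀)` in `U(2,1)`" (PerL l. 672).

THEOREM `dense_Delta : Dense (Delta V T hT : Set U21)` — this is `FormsModelT.Print_dense` /
the hypothesis `Dense (B.Δ : Set U21)` of `BallGlue.stepsPrint_of_ball` and `BallGlue.n33e_ball` for the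
dictionary value `B.Δ = Delta V T hT`, previously a PRINT input ([San] Cor. 3.5(iii) / [PR] Thm. 7.7, not held).
Proof: `RealApproximation.dense_kPoints` (Cayley transform) with `K = ι₁(L)`, which is dense in `ℂ` and
conjugation-stable because `L` is CM, plus a lift of `ι₁(L)`-rational `Hm^{ι₁}`-unitary matrices to `GL₃(L)`.
-/

set_option autoImplicit false

noncomputable section

open scoped Matrix ComplexConjugate

namespace HodgeCM
namespace PerL34
namespace RealApproximation

open Literature.AlgebraicGeometry.ShimuraVarieties (unitaryGroup mem_unitaryGroup_iff signatureMatrix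
  conjRingHomK embedding_conjRingHomK)
open BallModel (J GL3 U21 mat)

/-- The vendored `signatureMatrix 2` is the ball file's `J = diag(1,1,-1)`. -/
theorem signatureMatrix_two : signatureMatrix 2 = J := by
  ext i j
  fin_cases i <;> fin_cases j <;> simp [signatureMatrix, J, Fin.last]

/-- (Ported verbatim from the HodgeCMPerL package; no docstring in the source.) -/
theorem frame_mul_inv (T : GL3) :
    (T : Matrix (Fin 3) (Fin 3) ℂ) * ((T⁻¹ : GL3) : Matrix (Fin 3) (Fin 3) ℂ) = 1 := by
  rw [← Units.val_mul, mul_inv_cancel, Units.val_one]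

/-- (Ported verbatim from the HodgeCMPerL package; no docstring in the source.) -/
theorem frame_inv_mul (T : GL3) :
    ((T⁻¹ : GL3) : Matrix (Fin 3) (Fin 3) ℂ) * (T : Matrix (Fin 3) (Fin 3) ℂ) = 1 := by
  rw [← Units.val_mul, inv_mul_cancel, Units.val_one]

section Embedding

variable {L : CMField} (ι₁ : L →+* ℂ)

/-- `ι₁` on matrices intertwines `g ↦ (g^σ)ᵀ` (`σ = conjRingHomK L`) with `ᴴ`. -/
theorem map_star_transpose (g : Matrix (Fin 3) (Fin 3) L) :
    ((g.map (conjRingHomK L))ᵀ).map ι₁ = (g.map ι₁)ᴴ := by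
  ext i j
  simp [Matrix.conjTranspose_apply, embedding_conjRingHomK]

/-- `g ↦ T⁻¹ g^{ι₁} T : GL₃(L) →* GL₃(ℂ)`. -/
def toGL3 (T : GL3) : GL (Fin 3) L →* GL3 :=
  (MulAut.conj T⁻¹).toMonoidHom.comp (Matrix.GeneralLinearGroup.map ι₁)

/-- (Ported verbatim from the HodgeCMPerL package; no docstring in the source.) -/
theorem coe_toGL3 (T : GL3) (g : GL (Fin 3) L) :
    ((toGL3 ι₁ T g : GL3) : Matrix (Fin 3) (Fin 3) ℂ) =
      ((T⁻¹ : GL3) : Matrix (Fin 3) (Fin 3) ℂ) * (g : Matrix (Fin 3) (Fin 3) L).map ι₁ *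
        (T : Matrix (Fin 3) (Fin 3) ℂ) := by
  simp only [toGL3, MonoidHom.coe_comp, MulEquiv.coe_toMonoidHom, Function.comp_apply, MulAut.conj_apply,
    inv_inv, Units.val_mul]
  rfl

end Embedding

variable {L : CMField} {ι₁ : L →+* ℂ} (V : HermSpace3 L ι₁)

/-- A frame at `ι₁` exists (`HermSpace3.signature_ι₁`). -/
theorem exists_frame :
    ∃ T : GL3, (T : Matrix (Fin 3) (Fin 3) ℂ)ᴴ * V.Hm.map ι₁ * (T : Matrix (Fin 3) (Fin 3) ℂ) = J := by
  obtain ⟨T, hT⟩ := V.signature_ι₁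
  exact ⟨T, by rw [hT, signatureMatrix_two]⟩

/-- `Hm^{ι₁}` is hermitian. -/
theorem map_Hm_conjTranspose : (V.Hm.map ι₁)ᴴ = V.Hm.map ι₁ := by
  ext i j
  simp only [Matrix.conjTranspose_apply, Matrix.map_apply, Complex.star_def, ← embedding_conjRingHomK,
    V.isHermitian]

/-- `Hm^{ι₁}` has its entries in `ι₁(L)`. -/
theorem isKMat_Hm : IsKMat ι₁.fieldRange (V.Hm.map ι₁) := fun i j => ⟨V.Hm i j, rfl⟩

/-- An `L`-point of `U(V₃,h)` maps under `ι₁` into `U(Hm^{ι₁})`. -/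
theorem map_unitary {g : GL (Fin 3) L} (hg : g ∈ unitaryGroup (conjRingHomK L) V.Hm) :
    ((g : Matrix (Fin 3) (Fin 3) L).map ι₁)ᴴ * V.Hm.map ι₁ * (g : Matrix (Fin 3) (Fin 3) L).map ι₁ =
      V.Hm.map ι₁ := by
  have h := congrArg (fun M : Matrix (Fin 3) (Fin 3) L => M.map ι₁) (mem_unitaryGroup_iff.mp hg)
  simpa only [Matrix.map_mul, map_star_transpose] using h

variable (T : GL3) (hT : (T : Matrix (Fin 3) (Fin 3) ℂ)ᴴ * V.Hm.map ι₁ * (T : Matrix (Fin 3) (Fin 3) ℂ) = J)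

include hT in
/-- (Ported verbatim from the HodgeCMPerL package; no docstring in the source.) -/
theorem toGL3_mem_U21 {g : GL (Fin 3) L} (hg : g ∈ unitaryGroup (conjRingHomK L) V.Hm) :
    toGL3 ι₁ T g ∈ U21 := by
  show ((toGL3 ι₁ T g : GL3) : Matrix (Fin 3) (Fin 3) ℂ)ᴴ * J * ((toGL3 ι₁ T g : GL3) : Matrix (Fin 3) (Fin 3) ℂ) = J
  rw [coe_toGL3]
  exact coavatar_unitary hT (frame_mul_inv T) (map_unitary V hg)

/-- **`G_U(L₀) → U(2,1)`**, `g ↦ T⁻¹ g^{ι₁} T`, for a frame `T` at `ι₁`. -/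
def toU21 : unitaryGroup (conjRingHomK L) V.Hm →* U21 :=
  ((toGL3 ι₁ T).comp (unitaryGroup (conjRingHomK L) V.Hm).subtype).codRestrict U21
    fun g => toGL3_mem_U21 V T hT g.2

/-- (Ported verbatim from the HodgeCMPerL package; no docstring in the source.) -/
theorem mat_toU21 (g : unitaryGroup (conjRingHomK L) V.Hm) :
    mat (toU21 V T hT g) = ((T⁻¹ : GL3) : Matrix (Fin 3) (Fin 3) ℂ) *
      ((g : GL (Fin 3) L) : Matrix (Fin 3) (Fin 3) L).map ι₁ * (T : Matrix (Fin 3) (Fin 3) ℂ) :=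
  coe_toGL3 ι₁ T g

/-- **`Δ` = the image of `G_U(L₀)` in `U(2,1)`** (PerL v5 l. 672) — the dictionary value of `FormsModel.Δ`
over the ball model, for the frame `T`. -/
def Delta : Subgroup U21 := (toU21 V T hT).range

/-- **`Print_dense` (PerL v5 Prop 4.3, ll. 672–677: "`Δ` is dense in `U(2,1)`", there cited to [San] Cor. 3.5(iii)
/ [PR] Thm. 7.7) — PROVED:** the image of `G_U(L₀)` is dense in `U(2,1)`. -/
theorem dense_Delta : Dense (Delta V T hT : Set U21) := by
  have hK := conj_mem_fieldRange_of_isCMField ι₁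
  have hKd := dense_fieldRange_of_isTotallyComplex ι₁
  have hHd : (V.Hm.map ι₁).det ≠ 0 := det_ne_zero_of_frame hT (by rw [BallModel.det_J]; norm_num)
  have hTTi := frame_mul_inv T
  have hTiT := frame_inv_mul T
  have hd := dense_kPoints ι₁.fieldRange hK hKd (isKMat_Hm V) (map_Hm_conjTranspose V) hHd T J hT U21
    (fun _ => Iff.rfl)
  refine hd.mono ?_
  intro u hu
  change IsKMat ι₁.fieldRange
    ((T : Matrix (Fin 3) (Fin 3) ℂ) * mat u * ((T⁻¹ : GL3) : Matrix (Fin 3) (Fin 3) ℂ)) at hu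
  -- the `Hm^{ι₁}`-avatar `G = T u T⁻¹` of `u` and its lift to an `L`-matrix
  set G : Matrix (Fin 3) (Fin 3) ℂ :=
    (T : Matrix (Fin 3) (Fin 3) ℂ) * mat u * ((T⁻¹ : GL3) : Matrix (Fin 3) (Fin 3) ℂ) with hGdef
  have hGU : Gᴴ * V.Hm.map ι₁ * G = V.Hm.map ι₁ := avatar_unitary hT hTTi hTiT (BallModel.mat_mem u)
  have hGdet : G.det ≠ 0 := det_ne_zero_of_unitary hHd hGU
  choose g₀ hg₀ using fun i j => RingHom.mem_fieldRange.mp (hu i j)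
  let gm : Matrix (Fin 3) (Fin 3) L := Matrix.of g₀
  have hgm : gm.map ι₁ = G := by
    ext i j
    exact hg₀ i j
  have hgdet : gm.det ≠ 0 := by
    intro h0
    apply hGdet
    rw [← hgm, ← RingHom.mapMatrix_apply, ← RingHom.map_det, h0, map_zero]
  let g : GL (Fin 3) L := Matrix.GeneralLinearGroup.mkOfDetNeZero gm hgdet
  have hgU : g ∈ unitaryGroup (conjRingHomK L) V.Hm := by
    rw [mem_unitaryGroup_iff]
    apply Matrix.map_injective ι₁.injective
    change ((gm.map (conjRingHomK L))ᵀ * V.Hm * gm).map ι₁ = V.Hm.map ι₁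
    rw [Matrix.map_mul, Matrix.map_mul, map_star_transpose, hgm]
    exact hGU
  refine ⟨⟨g, hgU⟩, ?_⟩
  -- `toU21 g = u`
  apply Subtype.ext
  apply Units.ext
  change mat (toU21 V T hT ⟨g, hgU⟩) = mat u
  rw [mat_toU21]
  change ((T⁻¹ : GL3) : Matrix (Fin 3) (Fin 3) ℂ) * gm.map ι₁ * (T : Matrix (Fin 3) (Fin 3) ℂ) = mat u
  rw [hgm, hGdef]
  exact coavatar_avatar hTiT (mat u)

/-- Monotonicity: any subgroup of `U(2,1)` containing `Δ` is dense (for consumers whose `Δ` is larger). -/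
theorem dense_of_delta_le {Δ' : Subgroup U21} (h : Delta V T hT ≤ Δ') : Dense (Δ' : Set U21) :=
  (dense_Delta V T hT).mono h

/-- Shape of the line-spans consumers (`BallSpans.LineSpans.Δ S := S.Γ.map (MonoidHom.fst U21 _)`, pv03): if
`Γ ≤ U(2,1) × P` is the image of `G_U(L₀)` under `(toU21, ψ)` for ANY homomorphism `ψ` (e.g. into `G_c × G_f`),
then its first projection — which is `Δ` — is dense in `U(2,1)`. -/
theorem dense_map_fst_range {P : Type*} [Group P] (ψ : unitaryGroup (conjRingHomK L) V.Hm →* P) :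
    Dense ((((toU21 V T hT).prod ψ).range.map (MonoidHom.fst U21 P) : Subgroup U21) : Set U21) := by
  rw [MonoidHom.map_range, MonoidHom.fst_comp_prod]
  exact dense_Delta V T hT

/-- The same, in the shape of the `Dense Δ` hypothesis of `BallGlue.stepsPrint_of_ball` / `FormsModelT.Print_dense`:
for every hermitian 3-space there are a frame and the dense image `Δ`. -/
theorem exists_frame_dense : ∃ (T : GL3) (hT : (T : Matrix (Fin 3) (Fin 3) ℂ)ᴴ * V.Hm.map ι₁ *
    (T : Matrix (Fin 3) (Fin 3) ℂ) = J), Dense (Delta V T hT : Set U21) := by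
  obtain ⟨T, hT⟩ := exists_frame V
  exact ⟨T, hT, dense_Delta V T hT⟩

end RealApproximation
end PerL34
end HodgeCM

end

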